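import Summits.BirchSwinnertonDyer.Rank1Residual.Supersingular.KuriharaNumberModTwoVanishing
import Literature.NumberTheory.EllipticCurves.KatoKolyvaginPrimes
import HarnessLib

/-!
# `OrdLambdaHalfAtTwo` (crux `stmt-BirchSwinnertonDyer-19556`), line `two-power-slack-rigidity-two`:
# no UNIT scaled Kurihara number at `2` when the plus symbol is `q₀·(even)` at Kolyvagin denominators

Second negative (load-bearing) lemma for the SUPPLY statement `UnitKuriharaSupplyAtTwo` /
`UnitKuriharaWitnessAtTwo W f` of the crux sketch `Cruxes/OrdLambdaHalfAtTwo/TwoPowerSlackRigidityTwoSketch.lean`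
(cdisprove seat, `--supports stmt-BirchSwinnertonDyer-19556`; companion of
`Negative/UnitKuriharaWitnessLevelOne.lean`).  It isolates the EXACT finite hypothesis on the rational plus
symbol `r ↦ [r]⁺_f` under which NO scaling `c`, NO level `k ≥ 1`, NO Kolyvagin product `n ∈ 𝒩_k(W,2)` and NO
choice of discrete logarithms `ψ_ℓ` produces a unit `δ^{(c)}_n ∈ (ℤ/2^k)ˣ`:

* (`h₀`, primitivity) some value `[r₀]⁺_f = q₀·(2m₀+1)` is `q₀` times an ODD integer, and
* (`heven`, evenness on the class of the cusp `0`) every value `[r]⁺_f` at a rational `r` whose denominator is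
  prime to `2·N_W` is `q₀` times an EVEN integer.

Then (`not_isUnit_sum_of_even_values`) every admissible scaling `c` (`c·[r]⁺ ∈ ℤ₍₂₎` for all `r`) has
`|c q₀|₂ ≤ 1` by `h₀`, so `c·[a/n]⁺ = (c q₀)·(2m) ∈ 2ℤ₍₂₎` for every `a` and every Kolyvagin product `n`
(`(n, 2N_W) = 1`, `IsKolyvaginProduct.coprime`), every term of `δ^{(c)}_n` is divisible by `2` in `ℤ/2^k`,
and a multiple of `2` is not a unit of `ℤ/2^k`, `k ≥ 1`.  `not_exists_unit_witness_of_even_values` is the same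
statement in the exact (unfolded) shape of the sketch's `UnitKuriharaWitnessAtTwo W f`, so it transfers by
`Iff.rfl`.

WHY THE HYPOTHESIS IS THE RIGHT ONE (paper, exact arithmetic; evidence rows of kit jobs j313728/j313889 ff.
on the crux item): for the `+`-symbol `x` of a rational newform let `q₀` generate the value lattice `x(Δ₀)`
(gcd of the values on `ℤ[Γ₀(N)]`-generators / Manin symbols) and `Λ = x/q₀ : ℚ → ℤ` (primitive, so `h₀`
holds).  `γ ↦ Λ{∞, γ∞} mod 2` is a homomorphism `Γ₀(N) → ℤ/2` (`Λ{∞,γδ∞} = Λ{∞,γ∞} + Λ{∞,δ∞}` by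
`Γ₀(N)`-invariance); if it vanishes on a generating set (the edge-pairing matrices of a Farey symbol,
PARI `mspolygon`, resp. Sage `Gamma0(N).gens()`; flag `boundaryG = 1` of the job) then `Λ(r) mod 2` only
depends on the `Γ₀(N)`-class of the cusp `r`, and every `a/n` with `(n, N) = 1` lies in the class of `0`;
so `heven` holds as soon as moreover `Λ(0)` is even — automatically in positive analytic rank (`Λ(0) = 0`).
Measured instances (two independent engines, exact): `65a1` (rank 1, non-CM, good ordinary at 2, head of
the E5 collision class), `603a1`, `603b1` (rank 0, `Λ(0)` even).  For these curves the sketch's SUPPLY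
statement `UnitKuriharaSupplyAtTwo` fails outright (no witness at any `n`), which is recorded — with the
in-tree obstruction (no evaluation of `ratPlusSymbol` for a concrete newform) — in the crux work file
`Cruxes/OrdLambdaHalfAtTwo/Disproof.lean`.

No statement of the route is asserted; nothing here bears on `OrdLambdaHalfAtTwo` itself (BSD is not
proved by any of this).  References: C.-H. Kim, arXiv:2203.12159, §1.2.2 (`𝒫_k`, `𝒩_k`); M. Kurihara,
Doc. Math. Extra Vol. Kato (2003) 539–563 (`δ_n`); J. Cremona, Algorithms for Modular Elliptic Curves,
2nd ed., §2.2–2.8 (Manin symbols, cusp equivalence). [folklore]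
-/

set_option autoImplicit false

noncomputable section

open scoped Classical MatrixGroups ModularForm

open CongruenceSubgroup Literature.NumberTheory.EllipticCurves Literature.NumberTheory.EllipticCurves.ModularForms
open Literature.NumberTheory.DiophantineGeometry.Dioph (ratModP)
open Summit.BirchSwinnertonDyer.Rank1Residual.Supersingular

namespace Summit.BirchSwinnertonDyer.BirchSwinnertonDyer.Theorems.OrdLambdaHalfAtTwo.Negative

/-- A rational of `2`-adic norm `< 1` reduces into `2·(ℤ/2^k)`. [folklore] -/
theorem two_dvd_ratModP_pow_of_norm_lt_one {k : ℕ} {q : ℚ} (hq : ‖(q : ℚ_[2])‖ < 1) :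
    (2 : ZMod (2 ^ k)) ∣ ratModP (2 ^ k) q := by
  have hden : ¬ 2 ∣ q.den := not_dvd_den_of_norm_ratCast_le_one hq.le
  rw [ratModP_eq_toZModPow 2 k hden]
  set z : ℤ_[2] := ⟨(q : ℚ_[2]), Padic.norm_rat_le_one hden⟩ with hz_def
  have hz : ‖z‖ < 1 := hq
  obtain ⟨w, hw⟩ := (PadicInt.norm_lt_one_iff_dvd z).mp hz
  refine ⟨PadicInt.toZModPow k w, ?_⟩
  rw [hw, map_mul, map_natCast, Nat.cast_ofNat]

/-- `2` is not a unit of `ℤ/2^k` for `k ≥ 1`. [folklore] -/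
theorem not_isUnit_two_zmod_pow {k : ℕ} (hk : 1 ≤ k) : ¬ IsUnit (2 : ZMod (2 ^ k)) := by
  have h : ¬ (2 : ℕ).Coprime (2 ^ k) := by
    rw [Nat.coprime_pow_right_iff (by omega : 0 < k)]
    decide
  have h' := (ZMod.isUnit_iff_coprime 2 (2 ^ k)).not.mpr h
  simpa using h'

/-- An odd integer has `2`-adic norm `1`. [folklore] -/
theorem padicNorm_two_odd_eq_one (m : ℤ) : ‖((2 * m + 1 : ℤ) : ℚ_[2])‖ = 1 := by
  refine le_antisymm (Padic.norm_int_le_one _) (not_lt.mp fun h ↦ ?_)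
  have h2 : (2 : ℤ) ∣ 2 * m + 1 := by exact_mod_cast Padic.norm_intCast_lt_one_iff.mp h
  omega

/-- The denominator of `v / n` (`v n : ℕ`) divides `n`. [folklore] -/
theorem den_natCast_div_natCast_dvd (v n : ℕ) : ((v : ℚ) / n).den ∣ n := by
  have h : ((v : ℚ) / n) = Rat.divInt v n := by
    rw [Rat.divInt_eq_div]; push_cast; rfl
  have h2 : ((Rat.divInt v n).den : ℤ) ∣ (n : ℤ) := Rat.den_dvd v n
  rw [h]
  exact_mod_cast h2

/-- **No unit scaled Kurihara number at `2` under evenness of the symbol on the class of the cusp `0`.**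
If `[r₀]⁺_f = q₀(2m₀+1)` for some `r₀` and `[r]⁺_f ∈ q₀·2ℤ` for every `r` with denominator prime to `2N_W`,
then for every scaling `c` with `c·[r]⁺_f ∈ ℤ₍₂₎` (all `r`), every level `k ≥ 1`, every Kolyvagin product
`n ∈ 𝒩_k(W, 2)` and all discrete logarithms `ψ_ℓ`, the scaled Kurihara number
`δ^{(c)}_n = ∑_{a ∈ (ℤ/n)ˣ} ratModP (2^k) (c·[a/n]⁺_f) ∏_{ℓ∣n} ψ_ℓ(a)` (the sketch's `kuriharaNumberScaled f c k n ψ`,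
unfolded verbatim) is NOT a unit of `ℤ/2^k`. [folklore] -/
theorem not_isUnit_sum_of_even_values (W : WeierstrassCurve ℚ) [W.IsGloballyMinimal] {N : ℕ} [NeZero N]
    (f : CuspForm (Gamma0 N) 2) (q₀ r₀ : ℚ) (m₀ : ℤ) (h₀ : ratPlusSymbol f r₀ = q₀ * (2 * m₀ + 1))
    (heven : ∀ r : ℚ, r.den.Coprime (W.conductorNorm ℤ * 2) → ∃ m : ℤ, ratPlusSymbol f r = q₀ * (2 * m))
    (c : ℚ) (hc : ∀ r : ℚ, ‖((c * ratPlusSymbol f r : ℚ) : ℚ_[2])‖ ≤ 1)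
    {k n : ℕ} [NeZero n] (hk : 1 ≤ k) (hn : Kato.IsKolyvaginProduct W 2 k n)
    (ψ : (ℓ : ℕ) → (ZMod ℓ)ˣ →* Multiplicative (ZMod (2 ^ k))) :
    ¬ IsUnit (∑ a : (ZMod n)ˣ, ratModP (2 ^ k) (c * ratPlusSymbol f (((a : ZMod n).val : ℚ) / n)) *
      ∏ ℓ ∈ n.primeFactors.attach,
        Multiplicative.toAdd (ψ ℓ.1 (ZMod.unitsMap (Nat.dvd_of_mem_primeFactors ℓ.2) a))) := by
  -- `|c q₀|₂ ≤ 1` from the odd value at `r₀`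
  have hcq : ‖((c * q₀ : ℚ) : ℚ_[2])‖ ≤ 1 := by
    have h := hc r₀
    rw [h₀, show c * (q₀ * (2 * m₀ + 1)) = (c * q₀) * ((2 * m₀ + 1 : ℤ) : ℚ) by push_cast; ring,
      Rat.cast_mul, norm_mul, Rat.cast_intCast, padicNorm_two_odd_eq_one, mul_one] at h
    exact h
  -- every term is divisible by `2`
  have hterm : ∀ a : (ZMod n)ˣ,
      (2 : ZMod (2 ^ k)) ∣ ratModP (2 ^ k) (c * ratPlusSymbol f (((a : ZMod n).val : ℚ) / n)) := by
    intro a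
    apply two_dvd_ratModP_pow_of_norm_lt_one
    set r : ℚ := ((a : ZMod n).val : ℚ) / n with hr
    have hden : r.den ∣ n := den_natCast_div_natCast_dvd _ _
    have hcop : r.den.Coprime (W.conductorNorm ℤ * 2) := Nat.Coprime.coprime_dvd_left hden hn.coprime
    obtain ⟨m, hm⟩ := heven r hcop
    rw [hm, show c * (q₀ * (2 * m)) = (c * q₀) * ((2 * m : ℤ) : ℚ) by push_cast; ring,
      Rat.cast_mul, norm_mul, Rat.cast_intCast]
    have hlt : ‖((2 * m : ℤ) : ℚ_[2])‖ < 1 :=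
      Padic.norm_intCast_lt_one_iff.mpr (by exact_mod_cast dvd_mul_right 2 m)
    exact mul_lt_one_of_nonneg_of_lt_one_right hcq (norm_nonneg _) hlt
  -- hence the sum is divisible by `2`, which is not a unit
  intro hu
  have hdvd : (2 : ZMod (2 ^ k)) ∣ ∑ a : (ZMod n)ˣ,
      ratModP (2 ^ k) (c * ratPlusSymbol f (((a : ZMod n).val : ℚ) / n)) *
        ∏ ℓ ∈ n.primeFactors.attach,
          Multiplicative.toAdd (ψ ℓ.1 (ZMod.unitsMap (Nat.dvd_of_mem_primeFactors ℓ.2) a)) :=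
    Finset.dvd_sum fun a _ ↦ (hterm a).mul_right _
  exact not_isUnit_two_zmod_pow hk (isUnit_of_dvd_unit hdvd hu)

/-- **Consequence, in the exact shape of the sketch's `UnitKuriharaWitnessAtTwo W f` (unfolded verbatim, so it
transfers by `Iff.rfl`):** under `h₀` and `heven` the curve admits NO unit Kurihara witness at `2` — for no
scaling, level, Kolyvagin product or choice of logarithms.  This is the load-bearing hypothesis analysis of the
line's SUPPLY statement: any curve whose primitive plus symbol is a class function mod `2` with `Λ(0)` even
(e.g. `65a1`, `603a1`, `603b1` by exact computation, kit j313728/j313889) is a counterexample to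
`UnitKuriharaSupplyAtTwo` as stated. [folklore] -/
theorem not_exists_unit_witness_of_even_values (W : WeierstrassCurve ℚ) [W.IsElliptic] [W.IsGloballyMinimal]
    {N : ℕ} [NeZero N] (f : CuspForm (Gamma0 N) 2) (q₀ r₀ : ℚ) (m₀ : ℤ)
    (h₀ : ratPlusSymbol f r₀ = q₀ * (2 * m₀ + 1))
    (heven : ∀ r : ℚ, r.den.Coprime (W.conductorNorm ℤ * 2) → ∃ m : ℤ, ratPlusSymbol f r = q₀ * (2 * m)) :
    ¬ ∃ (c : ℚ) (k n : ℕ) (_ : NeZero n) (ψ : (ℓ : ℕ) → (ZMod ℓ)ˣ →* Multiplicative (ZMod (2 ^ k))),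
      c ≠ 0 ∧ (∀ r : ℚ, ‖((c * ratPlusSymbol f r : ℚ) : ℚ_[2])‖ ≤ 1) ∧ 1 ≤ k ∧
      Kato.IsKolyvaginProduct W 2 k n ∧ (∀ ℓ ∈ n.primeFactors, Function.Surjective (ψ ℓ)) ∧
      IsUnit (∑ a : (ZMod n)ˣ, ratModP (2 ^ k) (c * ratPlusSymbol f (((a : ZMod n).val : ℚ) / n)) *
        ∏ ℓ ∈ n.primeFactors.attach,
          Multiplicative.toAdd (ψ ℓ.1 (ZMod.unitsMap (Nat.dvd_of_mem_primeFactors ℓ.2) a))) := by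
  rintro ⟨c, k, n, _, ψ, -, hc, hk, hn, -, hu⟩
  exact not_isUnit_sum_of_even_values W f q₀ r₀ m₀ h₀ heven c hc hk hn ψ hu

end Summit.BirchSwinnertonDyer.BirchSwinnertonDyer.Theorems.OrdLambdaHalfAtTwo.Negative

end
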